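/-
b2b-lace packet, TAIL-BOUND ANALYST gen 9 (unit `b2b-lace-tail-g9`).  (S2b)-IMPR, support for the H₁ leaf (L3): the SLOT ALGEBRA of
[NoBLE17] §3.3.5 Step 1 after the `α_F`-correction of the printed x-space identity (3.61) (packet DIVERGENCE.md D80) — why the
`IM`-slots of `F3Bounds.boundH1` (= (3.62)–(3.64) = `General.nb` `BoundH[1]`, transcribed verbatim and UNCHANGED) dominate the
corrected x-space majorants under displayed side conditions.  d-generic; imports Mathlib only; no numeral, no dimension, no named
fact; every existing module untouched.  L3 itself (the analytic x-space bounds) is NOT in this module.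
-/
import Mathlib.Data.Real.Basic
import Mathlib.Tactic
import HarnessLib

/-!
# Literature.Probability.FitznerVanDerHofstad2017.NobleH1SlotAlgebra — the slot algebra of [NoBLE17] §3.3.5 Step 1

[NoBLE17] = Fitzner–van der Hofstad, *Generalized approach to the non-backtracking lace expansion*, PTRF 169 (2017) 1041–1119.

The Step-1 piece of the weighted diagram is `ℋ^{n,l}_{1,z}(x) = ∫ Ĥ₁(k) D̂(k)^l Ĝ_z(k)ⁿ D̂^{(x)}(k) dk/(2π)^d` ((3.58)), `n ∈ {0,1}`,
with `Ĥ₁ = (α_F (c_Φ + α_Φ D̂) Ĉ* + α_Φ) Ĉ* M̂*` ((3.52); kernel atom `LapAtoms.H1` of `NobleLaplacianSplit`),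
`Ĉ*(k) = 1/(1 − F̂_z(0) + α_F[1 − D̂(k)])` ((3.40)) and `M̂* = D̂ − 2 D̂^{sin} Ĉ*` ((3.45)).  Expanding, `ℋ₁` is a combination of
the x-space quantities

  `X_{m,l}(x) := ∫ D̂^l Ĉ*^{m+2} M̂* D̂^{(x)} dk/(2π)^d`  (`m = 0, 1`)   and   `Y_l(x) := ∫ D̂^l Ĉ* M̂* D̂^{(x)} dk/(2π)^d`

with coefficients `α_F c_Φ`, `α_F α_Φ`, `α_Φ` (`n = 0`: `X_{0,l}`, `X_{0,l+1}`, `Y_l`) and `α_F c_Φ²`, `2 α_F c_Φ α_Φ`, `α_F α_Φ²`,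
`α_Φ c_Φ`, `α_Φ²` (`n = 1`, main part: `X_{1,l}`, `X_{1,l+1}`, `X_{1,l+2}`, `X_{0,l}`, `X_{0,l+1}`), plus the remainder part (3.65).

READING NOTE (Lean-vs-print, recorded in the packet's DIVERGENCE.md as D80; nothing here decides it).  The print evaluates `X_{m,l}`
through the x-space identity (3.61), which uses `−ΔĈ* = Ĉ*² M̂*`; differentiating (3.40) once gives instead
`−ΔĈ* = α_F Ĉ*² (D̂ − 2 α_F D̂^{sin} Ĉ*)`, i.e. `Ĉ*^{m+2} M̂* = α_F⁻¹ Ĉ*^m (−ΔĈ*) + 2(α_F − 1) D̂^{sin} Ĉ*^{m+3}` (the two agree iff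
`α_F = 1`).  Carrying the correction through the massive-SRW dictionary of Step 1 (`C* ≤ α_F⁻¹ C` pointwise in x-space for `z ≤ z_c`,
`D^{sin}` = the kernel `1/(2d)` at `0`, `−1/(4d²)` at `±2e_ι`) one expects, for `α_F ≥ 1` and `2(m+3)+1 ≤ d`,

* `X_{m,l}(x) ≤ 𝓙_{m,l}(x)/α_F^{m+2} + (α_F − 1) I_{m+3,l}(x)/(d α_F^{m+3})`,
  `X_{m,l}(x) ≥ −(α_F − 1) S_{m+3,l}(x)/(2d² α_F^{m+3})`, `S_{p,l}(x) := Σ_{±ι} I_{p,l}(x ± 2e_ι)`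
  (print (3.62): `X_{m,l} ≤ 𝓙_{m,l}/α_F^{m+1}`; `𝓙` = `srwJ`, `I` = `srwI` of the tree);
* `Y_l(x) ≤ I_{1,l+1}(x)/α_F + S_{2,l}(x)/(2d² α_F²)` (= print (3.63), unaffected) and `Y_l(x) ≥ −I_{2,l}(x)/(d α_F²)`.

These four one-sided bounds are HYPOTHESES `hX`, `hX'`, `hY`, `hY'` of the lemmas below (to be proved by the L3 leaf); nothing is
assumed about them here.

THIS MODULE is the fact-free real-inequality algebra that turns them into the printed slots: under `1 ≤ α̲_F ≤ α_F ≤ ᾱ_F`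
(`a`, `α`, `amax` below), the table majorisation `𝓙 ≤ IM`, and the slot conditions

  (H-SC)   `I_{m+3,l}(x) ≤ d·α̲_F·IM[m,l,x]`,            (H-low)  `(ᾱ_F − 1)·S_{m+3,l}(x) ≤ 2d²·IM[m,l,x]`,
  (H-IM1)  `I_{1,l+1}(x) + S_{2,l}(x)/(2d² α̲_F) ≤ IM[−1,l,x]`,   (H-low1) `I_{2,l}(x) ≤ d·α̲_F·IM[−1,l,x]`,

one gets `|α_F^ε X_{m,l}(x)| ≤ IM[m,l,x]/α̲_F^{m+1−ε}` for `ε ∈ {0,1}` (= the power of `α_F` the slot's (3.52)-coefficient carries: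
`abs_alpha_mul_slot_le` for `ε = 1`, `abs_slot_le` for `ε = 0`) and `|Y_l(x)| ≤ IM[−1,l,x]/α̲_F` (`abs_m1_slot_le`) — EXACTLY the
`IM`-slots of `F3Bounds.boundH1` with their printed `α̲_F`-powers (`n = 0`: `c̄_Φ IM[0,l] + β_{α,Φ} IM[0,l+1] + (β_{α,Φ}/α̲_F) IM[−1,l]`;
`n = 1`: `(c̄_Φ²/α̲_F) IM[1,l] + 2(c̄_Φ β_{α,Φ}/α̲_F) IM[1,l+1] + (β_{α,Φ}²/α̲_F) IM[1,l+2] + (c̄_Φ β_{α,Φ}/α̲_F) IM[0,l] + (β_{α,Φ}²/α̲_F) IM[0,l+1]`).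
So no regrouping with `Ĥ₃` and no change of any cell is needed: a consumer discharges (H-SC), (H-low), (H-IM1), (H-low1) from its
SRW tables at the slots it reads, exactly as it discharges the `T`-slot hypothesis of `NobleH2Step`.  `printed_slot_iff` records that at
`α_F = α̲_F > 1` the condition (H-SC) (with `IM = 𝓙`) is also NECESSARY for the printed slot to dominate the corrected majorant.

Every declaration is an elementary theorem over `ℝ` (`dR` = the dimension as a real); the `[cite:]` tags are LOCATORS.
[cite: FitznerVanDerHofstad2016NoBLE, §3.3.5 Step 1 (3.59)–(3.66), (3.71) pp. 1074–1077 with (3.40), (3.45), (3.52) pp. 1071–1073;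
 FitznerVanDerHofstad2017, notebook General.nb In[2] `BoundH[1]`, SRW.nb `IM[n,l,v]`]
-/

namespace Literature.Probability.FitznerVanDerHofstad2017
namespace H1Slot

/-! ## The `m ≥ 0` slots (`Ĉ*^{m+2} M̂*`) -/

/-- Core upper chain at the true `α_F`: from the corrected majorant `hX`, the table majorisation `J ≤ IM` and the slot
condition `I ≤ d·α·IM` one recovers the printed coefficient `α^{−(m+1)}`.  (`dR` = the dimension as a real.)
[cite: FitznerVanDerHofstad2016NoBLE, §3.3.5 (3.62) p. 1076] -/
theorem upper_core {dR α J I IM X : ℝ} (m : ℕ) (hd : 0 < dR) (hα : 1 ≤ α) (hJ : J ≤ IM)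
    (hSC : I ≤ dR * α * IM) (hX : X ≤ J / α ^ (m + 2) + (α - 1) * I / (dR * α ^ (m + 3))) :
    X ≤ IM / α ^ (m + 1) := by
  have hα0 : 0 < α := by linarith
  have h1 : (α - 1) * I / (dR * α ^ (m + 3)) ≤ (α - 1) * (dR * α * IM) / (dR * α ^ (m + 3)) := by
    apply div_le_div_of_nonneg_right _ (by positivity)
    exact mul_le_mul_of_nonneg_left hSC (by linarith)
  have h2 : (α - 1) * (dR * α * IM) / (dR * α ^ (m + 3)) = (α - 1) * IM / α ^ (m + 2) := by
    field_simp
    ring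
  have h3 : J / α ^ (m + 2) ≤ IM / α ^ (m + 2) := div_le_div_of_nonneg_right hJ (by positivity)
  have h4 : IM / α ^ (m + 2) + (α - 1) * IM / α ^ (m + 2) = IM / α ^ (m + 1) := by
    field_simp
    ring
  linarith

/-- Core lower chain: from the lower majorant `hX'` and the slot condition `(amax − 1)·S ≤ 2d²·IM`.
[cite: FitznerVanDerHofstad2016NoBLE, §3.3.5 (3.62) p. 1076] -/
theorem lower_core {dR α amax S IM X : ℝ} (m : ℕ) (hd : 0 < dR) (hα : 1 ≤ α) (hαmax : α ≤ amax)
    (hS0 : 0 ≤ S) (hlow : (amax - 1) * S ≤ 2 * dR ^ 2 * IM)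
    (hX' : -((α - 1) * S / (2 * dR ^ 2 * α ^ (m + 3))) ≤ X) :
    -(IM / α ^ (m + 3)) ≤ X := by
  have hα0 : 0 < α := by linarith
  have h1 : (α - 1) * S ≤ (amax - 1) * S := mul_le_mul_of_nonneg_right (by linarith) hS0
  have h2 : (α - 1) * S / (2 * dR ^ 2 * α ^ (m + 3)) ≤ (2 * dR ^ 2 * IM) / (2 * dR ^ 2 * α ^ (m + 3)) :=
    div_le_div_of_nonneg_right (h1.trans hlow) (by positivity)
  have h3 : (2 * dR ^ 2 * IM) / (2 * dR ^ 2 * α ^ (m + 3)) = IM / α ^ (m + 3) := by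
    field_simp
  linarith

/-- Passing from the true `α_F` to the certified lower constant `α̲_F = a ≤ α_F` in a printed slot `IM / a^j`.
[folklore] -/
theorem div_pow_le_div_pow {a α IM : ℝ} (j : ℕ) (ha : 0 < a) (haα : a ≤ α) (hIM0 : 0 ≤ IM) :
    IM / α ^ j ≤ IM / a ^ j := by
  exact div_le_div_of_nonneg_left hIM0 (pow_pos ha j) (pow_le_pow_left₀ ha.le haα j)

/-- Lowering the exponent of an `α ≥ 1` denominator. [folklore] -/
theorem div_pow_le_div_pow_of_le {α IM : ℝ} {i j : ℕ} (hα : 1 ≤ α) (hij : i ≤ j) (hIM0 : 0 ≤ IM) :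
    IM / α ^ j ≤ IM / α ^ i := by
  have hα0 : 0 < α := by linarith
  exact div_le_div_of_nonneg_left hIM0 (pow_pos hα0 i) (pow_le_pow_right₀ hα hij)

/-- **D80 slot lemma, `ε = 0`** (the `Ĉ*²M̂*` group of the `n = 1` cell, coefficients `α_Φ c_Φ`, `α_Φ²`): the printed slot
`IM[m,l,x]/α̲_F^{m+1}` dominates `|X_{m,l}(x)|`.
[cite: FitznerVanDerHofstad2016NoBLE, §3.3.5 (3.64) p. 1076; FitznerVanDerHofstad2017, notebook General.nb In[2]] -/
theorem abs_slot_le {dR a α amax J I S IM X : ℝ} (m : ℕ) (hd : 0 < dR) (ha1 : 1 ≤ a) (haα : a ≤ α)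
    (hαmax : α ≤ amax) (hIM0 : 0 ≤ IM) (hJ : J ≤ IM) (hS0 : 0 ≤ S)
    (hSC : I ≤ dR * a * IM) (hlow : (amax - 1) * S ≤ 2 * dR ^ 2 * IM)
    (hX : X ≤ J / α ^ (m + 2) + (α - 1) * I / (dR * α ^ (m + 3)))
    (hX' : -((α - 1) * S / (2 * dR ^ 2 * α ^ (m + 3))) ≤ X) :
    |X| ≤ IM / a ^ (m + 1) := by
  have ha0 : 0 < a := by linarith
  have hα : 1 ≤ α := ha1.trans haα
  have hSC' : I ≤ dR * α * IM := by
    refine hSC.trans ?_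
    have : 0 ≤ dR * IM := mul_nonneg hd.le hIM0
    nlinarith
  have hup : X ≤ IM / a ^ (m + 1) :=
    (upper_core m hd hα hJ hSC' hX).trans (div_pow_le_div_pow (m + 1) ha0 haα hIM0)
  have hlo : -(IM / a ^ (m + 1)) ≤ X := by
    have h1 := lower_core m hd hα hαmax hS0 hlow hX'
    have h2 : IM / α ^ (m + 3) ≤ IM / α ^ (m + 1) := div_pow_le_div_pow_of_le hα (by omega) hIM0
    have h3 : IM / α ^ (m + 1) ≤ IM / a ^ (m + 1) := div_pow_le_div_pow (m + 1) ha0 haα hIM0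
    linarith
  exact abs_le.mpr ⟨hlo, hup⟩

/-- **D80 slot lemma, `ε = 1`** (the slots whose (3.52)-coefficient carries one `α_F`: all three `n = 0` main slots'
first two and the `Ĉ*³` group of the `n = 1` cell): the printed slot `IM[m,l,x]/α̲_F^{m}` dominates `|α_F X_{m,l}(x)|`.
[cite: FitznerVanDerHofstad2016NoBLE, §3.3.5 (3.62), (3.64) p. 1076; FitznerVanDerHofstad2017, notebook General.nb In[2]] -/
theorem abs_alpha_mul_slot_le {dR a α amax J I S IM X : ℝ} (m : ℕ) (hd : 0 < dR) (ha1 : 1 ≤ a) (haα : a ≤ α)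
    (hαmax : α ≤ amax) (hIM0 : 0 ≤ IM) (hJ : J ≤ IM) (hS0 : 0 ≤ S)
    (hSC : I ≤ dR * a * IM) (hlow : (amax - 1) * S ≤ 2 * dR ^ 2 * IM)
    (hX : X ≤ J / α ^ (m + 2) + (α - 1) * I / (dR * α ^ (m + 3)))
    (hX' : -((α - 1) * S / (2 * dR ^ 2 * α ^ (m + 3))) ≤ X) :
    |α * X| ≤ IM / a ^ m := by
  have ha0 : 0 < a := by linarith
  have hα : 1 ≤ α := ha1.trans haα
  have hα0 : 0 < α := by linarith
  have hSC' : I ≤ dR * α * IM := by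
    refine hSC.trans ?_
    have : 0 ≤ dR * IM := mul_nonneg hd.le hIM0
    nlinarith
  have hup0 : X ≤ IM / α ^ (m + 1) := upper_core m hd hα hJ hSC' hX
  have hup : α * X ≤ IM / a ^ m := by
    have h1 : α * X ≤ α * (IM / α ^ (m + 1)) := mul_le_mul_of_nonneg_left hup0 hα0.le
    have h2 : α * (IM / α ^ (m + 1)) = IM / α ^ m := by
      field_simp
      ring
    have h3 : IM / α ^ m ≤ IM / a ^ m := div_pow_le_div_pow m ha0 haα hIM0
    linarith
  have hlo : -(IM / a ^ m) ≤ α * X := by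
    have h1 := lower_core m hd hα hαmax hS0 hlow hX'
    have h1' : α * -(IM / α ^ (m + 3)) ≤ α * X := mul_le_mul_of_nonneg_left h1 hα0.le
    have h2 : α * -(IM / α ^ (m + 3)) = -(IM / α ^ (m + 2)) := by
      field_simp
      ring
    have h3 : IM / α ^ (m + 2) ≤ IM / α ^ m := div_pow_le_div_pow_of_le hα (by omega) hIM0
    have h4 : IM / α ^ m ≤ IM / a ^ m := div_pow_le_div_pow m ha0 haα hIM0
    linarith
  exact abs_le.mpr ⟨hlo, hup⟩

/-- At `α_F = α̲_F` the slot condition (H-SC) is also NECESSARY for the printed slot `J/α^{m+1}` to dominate the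
corrected majorant (with `J = IM`): the D80 criterion `SC ≤ 1` is exact.
[cite: FitznerVanDerHofstad2016NoBLE, §3.3.5 (3.62) p. 1076] -/
theorem printed_slot_iff {dR α J I : ℝ} (m : ℕ) (hd : 0 < dR) (hα : 1 < α) :
    J / α ^ (m + 2) + (α - 1) * I / (dR * α ^ (m + 3)) ≤ J / α ^ (m + 1) ↔ I ≤ dR * α * J := by
  have hα0 : 0 < α := by linarith
  have hα1 : 0 < α - 1 := by linarith
  have key : J / α ^ (m + 1) - (J / α ^ (m + 2) + (α - 1) * I / (dR * α ^ (m + 3)))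
      = (α - 1) / (dR * α ^ (m + 3)) * (dR * α * J - I) := by
    field_simp
    ring
  have hc : 0 < (α - 1) / (dR * α ^ (m + 3)) := by positivity
  constructor
  · intro h
    have h0 : 0 ≤ (α - 1) / (dR * α ^ (m + 3)) * (dR * α * J - I) := by rw [← key]; linarith
    have := nonneg_of_mul_nonneg_right (by simpa [mul_comm] using h0) hc
    linarith
  · intro h
    have h0 : 0 ≤ (α - 1) / (dR * α ^ (m + 3)) * (dR * α * J - I) := mul_nonneg hc.le (by linarith)
    rw [← key] at h0
    linarith

/-! ## The `m = −1` slot (`Ĉ* M̂*`, the third summand of the `n = 0` cell) -/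

/-- **D80 `m = −1` slot**: with the PRINTED (3.63) majorant `hY` (valid) and its lower companion `hY'`, the notebook
slot `IM[−1,l,x]/α̲_F` dominates `|Y_l(x)|` under (H-IM1) and (H-low1) — i.e. provided the certificate's `IM[−1,·]`
entries dominate the printed form (General.nb's own `IM[−1,l,v]` = `𝓙_{−1,l}(v)` does NOT in general; see D80 (6)).
[cite: FitznerVanDerHofstad2016NoBLE, §3.3.5 (3.63) p. 1076; FitznerVanDerHofstad2017, notebook General.nb In[2]] -/
theorem abs_m1_slot_le {dR a α I1 I2 S2 IM1 Y : ℝ} (hd : 0 < dR) (ha1 : 1 ≤ a) (haα : a ≤ α)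
    (hI1 : 0 ≤ I1) (hS2 : 0 ≤ S2) (hIM1 : I1 + S2 / (2 * dR ^ 2 * a) ≤ IM1) (hlow1 : I2 ≤ dR * a * IM1)
    (hY : Y ≤ I1 / α + S2 / (2 * dR ^ 2 * α ^ 2)) (hY' : -(I2 / (dR * α ^ 2)) ≤ Y) :
    |Y| ≤ IM1 / a := by
  have ha0 : 0 < a := by linarith
  have hα0 : 0 < α := by linarith
  have hIM1_0 : 0 ≤ IM1 := by
    have : 0 ≤ S2 / (2 * dR ^ 2 * a) := by positivity
    linarith
  have hup : Y ≤ IM1 / a := by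
    have h1 : I1 / α ≤ I1 / a := div_le_div_of_nonneg_left hI1 ha0 haα
    have h2 : S2 / (2 * dR ^ 2 * α ^ 2) ≤ S2 / (2 * dR ^ 2 * a ^ 2) := by
      have hsq : a ^ 2 ≤ α ^ 2 := pow_le_pow_left₀ ha0.le haα 2
      exact div_le_div_of_nonneg_left hS2 (by positivity) (by nlinarith)
    have h3 : I1 / a + S2 / (2 * dR ^ 2 * a ^ 2) = (I1 + S2 / (2 * dR ^ 2 * a)) / a := by
      field_simp
    have h4 : (I1 + S2 / (2 * dR ^ 2 * a)) / a ≤ IM1 / a := div_le_div_of_nonneg_right hIM1 ha0.le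
    linarith
  have hlo : -(IM1 / a) ≤ Y := by
    have h1 : I2 / (dR * α ^ 2) ≤ (dR * a * IM1) / (dR * α ^ 2) := div_le_div_of_nonneg_right hlow1 (by positivity)
    have h2 : (dR * a * IM1) / (dR * α ^ 2) = a * IM1 / α ^ 2 := by
      field_simp
    have h3 : a * IM1 / α ^ 2 ≤ a * IM1 / a ^ 2 :=
      div_le_div_of_nonneg_left (mul_nonneg ha0.le hIM1_0) (by positivity) (pow_le_pow_left₀ ha0.le haα 2)
    have h4 : a * IM1 / a ^ 2 = IM1 / a := by
      field_simp
    linarith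
  exact abs_le.mpr ⟨hlo, hup⟩

end H1Slot
end Literature.Probability.FitznerVanDerHofstad2017
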